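import Literature.AlgebraicGeometry.Hyperkaehler.GeneralizedKummerType
import Literature.AlgebraicGeometry.HodgeTheory.GysinFormalism
import Mathlib.RepresentationTheory.Coinvariants
import Mathlib.CategoryTheory.Endomorphism
import HarnessLib

/-!
# The translation group `Γ(X) ≅ (ℤ/5)⁴` of a variety of `Kum⁴`-type and its action on cohomology — DEFINITIONS + NAMED FACTS

Layer `Literature/AlgebraicGeometry/Hyperkaehler`.  Vocabulary and CITE records for the cell
`hodge-kum4` (ladder HodgeAV, rung H3: the Hodge conjecture for every smooth projective variety of
`Kum⁴`-type; cell home run/shared/lean/pub/hodge-kum4/, seat p2; graded input list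
HOME/lit/LIT-GRADES-r1.md rows L3.2, L3.6; referee REF-AUDIT-2 anchors (β), (γ)).

For a hyper-Kähler variety `X` of `Kumⁿ`-type the group `Aut₀(X)` of automorphisms acting
trivially on `H²(X, ℤ)` is `(ℤ/(n+1))⁴ ⋊ ℤ/2` (Boissière–Nieper-Wißkirchen–Sarti for `Kⁿ(A)`:
`Aut₀(Kⁿ(A)) = A[n+1] ⋊ ⟨−1⟩`; deformation invariance by Hassett–Tschinkel), and its normal
subgroup `Γ ≅ (ℤ/(n+1))⁴` — at the Kummer point, the translations by `A[n+1]` — is "the subgroup of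
automorphisms which act trivially on `H³`" (Floccari).  We DEFINE `Γ(X)` intrinsically, for any
`ℂ`-scheme `X`, as the subgroup of `Aut X` acting trivially on `H²(X(ℂ); ℂ)` and on `H³(X(ℂ); ℂ)`
(`autFixingH2H3 X`), together with its representation `g ↦ (g⁻¹)^*` on each `Hᵏ(X(ℂ); ℂ)`
(`translationRep X k`; with real coefficients `translationRepReal X k`), and record two printed facts
about `Kum⁴`-type (`n + 1 = 5` prime):

* `Floccari2026_card_autFixingH2H3_kum4Type` — `|Γ(X)| = 625`;
* `Foster2024_translationAction_kum4Type` — the `Γ(X)`-non-invariant part of `H⁸(X(ℂ); ℂ)` (the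
  augmentation submodule `𝒦 = span{ρ(g)c − c}`, Mathlib's `Representation.Coinvariants.ker`) has
  dimension `≤ 624 = |Γ| − 1`, and `Γ(X)` acts trivially on `Hᵏ(X(ℂ); ℂ)` for every `k ≠ 8`.

## Sources (read: arXiv texts `paper:arxiv-2501.02315` p0014, `paper:arxiv-2308.02267` p0006,
`paper:arxiv-2303.14327` p0024–p0025)

* S. Floccari, *K3 surfaces associated with varieties of generalized Kummer type*, Geom. Topol. 30
  (2026) 1129–1154 [`Floccari2026`, REFEREED], proof of Prop. 4.6 (p0014 L15–L16), verbatim: "By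
  [hassettTschinkel], the group `Aut₀(X)` of automorphisms inducing the identity on `H²(X,ℤ)` is
  deformation invariant, for any hyper-Kähler manifold `X`. It was computed in [boissiere2011higher]
  that for `Kⁿ(A)` we have `Aut₀(Kⁿ(A)) = A_{n+1} ⋊ ⟨−1⟩`; thus, any `K` of `Kumⁿ`-type admits an
  action of `Aut₀(K) ≅ (ℤ/(n+1)ℤ)⁴ ⋊ ℤ/2ℤ`."
* S. Floccari, *The Hodge and Tate conjectures for hyper-Kähler sixfolds of generalized Kummer type*
  (arXiv:2308.02267) [`Floccari2023`], §2.5 (p0006 L58–L70), verbatim: "`Aut₀(K³(A)) = A₄ ⋊ ⟨−1⟩`,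
  where the second factor acts on the first as the inverse. The action on `K³(A)` is induced by the
  natural action on `A^[4]`; by [oguiso2020no], the involution `−1` acts as multiplication by `−1` on
  the third cohomology. […] Let `Γ := A₄ ⊂ Aut₀(K³(A))`; it is the subgroup of automorphisms which
  act trivially on `H³(K³(A),ℤ)` […]. Thanks to the deformation-invariance of the automorphisms
  trivial on the second cohomology, for any `K` of `Kum³`-type we have `Aut₀(K) ≅ (ℤ/4ℤ)⁴ ⋊ ℤ/2ℤ`,
  and the subgroups `G ≅ (ℤ/2ℤ)⁵` and `Γ ≅ (ℤ/4ℤ)⁴`."  (The same words apply to `n = 4`, `Γ ≅ (ℤ/5)⁴`.)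
* J. Foster, *The Lefschetz standard conjectures for IHSMs of generalized Kummer deformation type in
  certain degrees*, Eur. J. Math. 10 (2024) [`Foster2024`, REFEREED]: Prop. 82 (p0024: the
  Göttsche–Soergel decomposition of `H*(A × Kum_n(A))` is `Γ`-equivariant with `Γ` acting on the
  sector of the partition `ν` through the regular representation of `d(ν)Γ`); Example 3 (p0024
  L102–L108): "Let `ν = (n+1)` […] The group `Γ` is isomorphic to `A[n+1]`. There is a transitive
  `Γ`-action […] which yields a `Γ`-regular representation […] in the middle cohomology"; Lemma 85
  and its proof (p0024–p0025): for `j` the smallest prime dividing `n + 1`, "if `k < 2(n+1)(j-1)/j`,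
  then `H^k(A × Kum_n(A), ℚ)` is `Γ`-invariant and by the Künneth theorem this implies that
  `H^k(Kum_n(A), ℚ)` is `Γ`-invariant as well. `H^k(Y_t, ℚ)` is therefore `Γ`-invariant by Lemma
  (deformation invariant)"; Remark 88 (p0025): for `n + 1` prime "the image of `i^*` is surjective in
  all degrees `k < 2n`. In the middle degree `k = 2n`, […] `H^{2n}(Y_t, ℚ)` is spanned by a
  `Γ`-regular representation. The prior classes are `Γ`-invariant".

## Rendering and faithfulness

* `Γ(X)`: with `ℂ`-coefficients (`HodgeTheory.complexBetti.map`); acting trivially on `H²(X(ℂ); ℂ)`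
  ⟺ on `H²(X, ℤ)` for `X` of `Kumⁿ`-type (`H²(X, ℤ)` is torsion-free, `X` being simply connected), so
  `Γ(X) ⊆ Aut₀(X)`, and inside `Aut₀(X) ≅ (ℤ/5)⁴ ⋊ ℤ/2` the elements acting trivially on `H³` are exactly
  the normal subgroup `(ℤ/5)⁴` (the coset of `−1` acts as `−1` on `H³ ≠ 0`, Oguiso; the translations
  act trivially on `Hᵏ`, `k < 2n`, Foster Lemma 85).  Hence `|Γ(X)| = 5⁴ = 625` — fact 1.
* Fact 2: for `n = 4` (`j = 5`, `2(n+1)(j-1)/j = 8`), `Γ` acts trivially on `Hᵏ(X(ℂ))` for `k < 8`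
  (Lemma 85), and for `k > 8` by `Γ`-equivariant Poincaré duality `Hᵏ ≅ (H^{16-k})^∨` (standard; not
  spelled out in print); in degree `8`, "spanned by a `Γ`-regular representation" plus invariant
  classes means every non-trivial character of `Γ` occurs with multiplicity `≤ 1`, i.e. the
  non-invariant part `𝒦 = ⊕_{χ ≠ 1} H⁸_χ` has `dim 𝒦 ≤ |Γ| − 1 = 624` (numerically `b₈ = 1046`,
  `dim H⁸(K⁴(A))^Γ = 422`, Göttsche).  Both transported from `K⁴(A)` to every `X` of `Kum⁴`-type by the
  deformation invariance of the `Aut₀`-action (Hassett–Tschinkel Thm. 2.1, as quoted by Floccari).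
* Stated for `n = 4` only (the cell's need); `-- TODO(general form)`: `|Γ(X)| = (n+1)⁴` for all
  `n ≥ 2`, and Foster's degree bound `k < 2(n+1)(j-1)/j` for general `n`.

## What is NOT here

The semidirect-product structure with the involution (recorded with the fixed fourfold `W_X`,
Floccari 2026 Lemma 4.2 / Prop. 4.6, in a sibling file); any proof; the LLV algebra.

## Added 2026-08-25 (literature seat of `hodge-kum4`)

* NAMED FACT `FloccariVaresco2024_autFixingH2H3_equiv_kumType` — `Γ(X) ≅ (ℤ/(n+1)ℤ)⁴` as a group for
  every smooth projective `Kumⁿ`-type `X`, `n ≥ 2` (Floccari–Varesco, Math. Ann. 2025, §3 ¶1, verbatim: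
  "form a group `Γₙ ≅ (ℤ/(n+1)ℤ)⁴`, by [BNWS, Hassett–Tschinkel]"; arXiv:2308.04865 p. 6 L4), with
  PROVED consequences `card_eq` (`|Γ(X)| = (n+1)⁴`), `floccari2026_card` (this record ⟹
  `Floccari2026_card_autFixingH2H3_kum4Type`), and `exists_frame_kum4Type` (a faithful action of
  `(ℤ/5)⁴` on `X` by endomorphisms trivial on `H²`, `H³` — the body of the planner's
  `KummerTranslationFrameExists`, HOME/plan/Statement.lean §1).  +1 named fact (refereed, cited at the
  line; it is STRONGER than, not a restatement of, the cardinality record).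
-/

noncomputable section

open CategoryTheory
open Literature.AlgebraicGeometry.HodgeTheory

namespace Literature.AlgebraicGeometry.Hyperkaehler

/-! ### `Γ(X)` and its representation on `Hᵏ(X(ℂ); ℂ)` -/

/-- **`Γ(X)`: the automorphisms of the `ℂ`-scheme `X` acting trivially on `H²(X(ℂ); ℂ)` and on
`H³(X(ℂ); ℂ)`** (a subgroup of `Aut X`, `X ∈ Over (Spec ℂ)`).  For `X` of `Kumⁿ`-type this is the
translation subgroup `(ℤ/(n+1))⁴ ◁ Aut₀(X) = (ℤ/(n+1))⁴ ⋊ ℤ/2` ("`Γ := A₄ ⊂ Aut₀(K³(A))`; it is the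
subgroup of automorphisms which act trivially on `H³`"). [cite: Floccari2023, §2.5] -/
def autFixingH2H3 (X : Motives.SchemeOver ℂ) : Subgroup (Aut X) where
  carrier := {g | complexBetti.map g.hom 2 = 𝟙 _ ∧ complexBetti.map g.hom 3 = 𝟙 _}
  one_mem' := ⟨complexBetti.map_id _, complexBetti.map_id _⟩
  mul_mem' := by
    rintro g h ⟨hg2, hg3⟩ ⟨hh2, hh3⟩
    refine ⟨?_, ?_⟩
    · change complexBetti.map (h.hom ≫ g.hom) 2 = _
      rw [complexBetti.map_comp, hg2, hh2, Category.comp_id]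
    · change complexBetti.map (h.hom ≫ g.hom) 3 = _
      rw [complexBetti.map_comp, hg3, hh3, Category.comp_id]
  inv_mem' := by
    rintro g ⟨hg2, hg3⟩
    have hcomp : g.hom ≫ (g⁻¹).hom = 𝟙 X := by
      have h1 : (g⁻¹ * g).hom = (1 : Aut X).hom := by rw [inv_mul_cancel]
      exact h1
    refine ⟨?_, ?_⟩
    · have h := complexBetti.map_comp g.hom (g⁻¹).hom 2
      rw [hcomp, complexBetti.map_id, hg2, Category.comp_id] at h
      exact h.symm
    · have h := complexBetti.map_comp g.hom (g⁻¹).hom 3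
      rw [hcomp, complexBetti.map_id, hg3, Category.comp_id] at h
      exact h.symm

/-- Unfolding: `g ∈ Γ(X)` iff `g^* = 1` on `H²(X(ℂ); ℂ)` and on `H³(X(ℂ); ℂ)`.
[cite: Floccari2023, §2.5] -/
theorem mem_autFixingH2H3_iff {X : Motives.SchemeOver ℂ} (g : Aut X) :
    g ∈ autFixingH2H3 X ↔ complexBetti.map g.hom 2 = 𝟙 _ ∧ complexBetti.map g.hom 3 = 𝟙 _ :=
  Iff.rfl

/-- **The representation of `Γ(X)` on `Hᵏ(X(ℂ); ℂ)`**, `g ↦ (g⁻¹)^*` (pull-back along the inverse,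
so that it is a homomorphism; at the Kummer point: the action of the translations `A[n+1]` on
`Hᵏ(Kⁿ(A))`). [cite: Floccari2023, §2.5] -/
def translationRep (X : Motives.SchemeOver ℂ) (k : ℕ) :
    Representation ℂ (autFixingH2H3 X) (complexBetti X k) where
  toFun g := (complexBetti.map (g⁻¹ : autFixingH2H3 X).val.hom k).hom
  map_one' := by
    rw [inv_one]
    change (complexBetti.map (𝟙 X) k).hom = _
    rw [complexBetti.map_id]
    rfl
  map_mul' g h := by
    rw [mul_inv_rev]
    change (complexBetti.map ((g⁻¹).val.hom ≫ (h⁻¹).val.hom) k).hom = _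
    rw [complexBetti.map_comp]
    rfl

/-- `ρ(g) c = (g⁻¹)^* c`. [cite: Floccari2023, §2.5] -/
theorem translationRep_apply {X : Motives.SchemeOver ℂ} {k : ℕ} (g : autFixingH2H3 X)
    (c : complexBetti X k) :
    translationRep X k g c = (complexBetti.map (g⁻¹ : autFixingH2H3 X).val.hom k).hom c :=
  rfl

/-- Elements of `Γ(X)` act trivially on `H²`: `ρ(g) = 1` on `H²(X(ℂ); ℂ)` (by definition).
[cite: Floccari2023, §2.5] -/
theorem translationRep_two_apply {X : Motives.SchemeOver ℂ} (g : autFixingH2H3 X)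
    (c : complexBetti X 2) : translationRep X 2 g c = c := by
  rw [translationRep_apply, ((mem_autFixingH2H3_iff _).1 (g⁻¹).2).1]
  rfl

/-- Elements of `Γ(X)` act trivially on `H³`: `ρ(g) = 1` on `H³(X(ℂ); ℂ)` (by definition).
[cite: Floccari2023, §2.5] -/
theorem translationRep_three_apply {X : Motives.SchemeOver ℂ} (g : autFixingH2H3 X)
    (c : complexBetti X 3) : translationRep X 3 g c = c := by
  rw [translationRep_apply, ((mem_autFixingH2H3_iff _).1 (g⁻¹).2).2]
  rfl

/-! ### The same action with real coefficients (for signature arguments) -/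

/-- **The representation of `Γ(X)` on `Hᵏ(X(ℂ); ℝ)`** (real coefficients), `g ↦ (g⁻¹)^*` — the
carrier on which signatures and Hodge–Riemann positivity are stated (the `G`-signature route to
`[W_X]² = 6`, cell blueprint G2-AUDIT §A5′). [cite: Floccari2023, §2.5] -/
def translationRepReal (X : Motives.SchemeOver ℂ) (k : ℕ) :
    Representation ℝ (autFixingH2H3 X)
      (AlgebraicTopology.SingularHomology.singularCohomology ℝ ℝ (Motives.ComplexPoints X) k) where
  toFun g := (AlgebraicTopology.SingularHomology.singularCohomology.map ℝ ℝ
    (Motives.AlgPoints.mapContinuous (L := ℂ) (g⁻¹ : autFixingH2H3 X).val.hom) k).hom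
  map_one' := by
    rw [inv_one]
    change (AlgebraicTopology.SingularHomology.singularCohomology.map ℝ ℝ
      (Motives.AlgPoints.mapContinuous (L := ℂ) (𝟙 X)) k).hom = _
    rw [Motives.AlgPoints.mapContinuous_id, AlgebraicTopology.SingularHomology.singularCohomology.map_id]
    rfl
  map_mul' g h := by
    rw [mul_inv_rev]
    change (AlgebraicTopology.SingularHomology.singularCohomology.map ℝ ℝ
      (Motives.AlgPoints.mapContinuous (L := ℂ) ((g⁻¹).val.hom ≫ (h⁻¹).val.hom)) k).hom = _
    rw [Motives.AlgPoints.mapContinuous_comp, AlgebraicTopology.SingularHomology.singularCohomology.map_comp]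
    rfl

/-- `ρ_ℝ(g) c = (g⁻¹)^* c`. [cite: Floccari2023, §2.5] -/
theorem translationRepReal_apply {X : Motives.SchemeOver ℂ} {k : ℕ} (g : autFixingH2H3 X)
    (c : AlgebraicTopology.SingularHomology.singularCohomology ℝ ℝ (Motives.ComplexPoints X) k) :
    translationRepReal X k g c =
      (AlgebraicTopology.SingularHomology.singularCohomology.map ℝ ℝ
        (Motives.AlgPoints.mapContinuous (L := ℂ) (g⁻¹ : autFixingH2H3 X).val.hom) k).hom c :=
  rfl

/-! ### The named facts for `Kum⁴`-type -/

/-- **`|Γ(X)| = 625 = 5⁴` for every smooth projective `X` of `Kum⁴`-type** — Floccari 2026, proof of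
Prop. 4.6: "any `K` of `Kumⁿ`-type admits an action of `Aut₀(K) ≅ (ℤ/(n+1)ℤ)⁴ ⋊ ℤ/2ℤ`"
(Boissière–Nieper-Wißkirchen–Sarti at the Kummer point, Hassett–Tschinkel's deformation invariance),
with Floccari 2023 §2.5: the translation subgroup is "the subgroup of automorphisms which act trivially
on `H³`" (the coset of `−1` acts as `−1` on `H³ ≠ 0`, Oguiso), and an automorphism acting trivially
on `H²(X(ℂ); ℂ)` acts trivially on the torsion-free `H²(X, ℤ)`.  Rendering: `Nat.card` (so the
statement includes finiteness).  Stated for `n = 4`.  A THEOREM in print, unproved in the tree.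
[cite: Floccari2026, §4.4 proof of Prop. 4.6] [cite: Floccari2023, §2.5] -/
def Floccari2026_card_autFixingH2H3_kum4Type : Prop :=
  ∀ ⦃X : Motives.SchemeOver ℂ⦄, Motives.IsSmoothProjective 8 X → IsOfGeneralizedKummerType 4 X →
    Nat.card (autFixingH2H3 X) = 625
-- TODO(general form): `Nat.card (autFixingH2H3 X) = (n + 1) ^ 4` for `X` of `Kumⁿ`-type, `n ≥ 2`.

/-- **Foster 2024 (Lemma 85, Prop. 82/87, Example 3, Remark 88), `n + 1 = 5` prime: the action of
`Γ(X)` on the cohomology of a smooth projective `X` of `Kum⁴`-type** — (i) the `Γ(X)`-non-invariant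
part `𝒦 = span{ρ(g)c − c}` of `H⁸(X(ℂ); ℂ)` — and (i′) of `H⁸(X(ℂ); ℝ)` — has dimension
`≤ 624 = |Γ| − 1` ("`H^{2n}(Y_t, ℚ)` is spanned by a `Γ`-regular representation", the prior classes
being `Γ`-invariant: every non-trivial character occurs at most once; the statement is over `ℚ`, so it
holds after any extension of scalars), and (ii) `Γ(X)` acts trivially on `Hᵏ(X(ℂ); ℂ)` for every `k ≠ 8`
(Lemma 85 for `k < 8 = 2(n+1)(j-1)/j`; for `k > 8` by `Γ`-equivariant Poincaré duality — standard,
not spelled out in print; transported to every `X` of `Kum⁴`-type by Hassett–Tschinkel's deformation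
invariance of the `Aut₀`-action, Foster's Lemma "deformation invariant").  A THEOREM in print,
unproved in the tree. [cite: Foster2024, Lemma 85, Example 3, Prop. 87 and Remark 88]
[cite: Floccari2026, §4.4 proof of Prop. 4.6] -/
def Foster2024_translationAction_kum4Type : Prop :=
  ∀ ⦃X : Motives.SchemeOver ℂ⦄, Motives.IsSmoothProjective 8 X → IsOfGeneralizedKummerType 4 X →
    Module.finrank ℂ (Representation.Coinvariants.ker (translationRep X 8)) ≤ 624 ∧
      Module.finrank ℝ (Representation.Coinvariants.ker (translationRepReal X 8)) ≤ 624 ∧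
        ∀ (k : ℕ), k ≠ 8 → ∀ g : Aut X, g ∈ autFixingH2H3 X → complexBetti.map g.hom k = 𝟙 _
-- TODO(general form): Foster's bound `k < 2(n+1)(j-1)/j`, `j` the least prime factor of `n + 1`,
-- and the regular representation in degree `2n` for `n + 1` prime.

namespace Foster2024_translationAction_kum4Type

/-- Clause (i): `dim 𝒦 ≤ 624`. [cite: Foster2024, Remark 88] -/
theorem finrank_coinvariantsKer_le (h : Foster2024_translationAction_kum4Type)
    {X : Motives.SchemeOver ℂ} (hX : Motives.IsSmoothProjective 8 X)
    (hK : IsOfGeneralizedKummerType 4 X) :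
    Module.finrank ℂ (Representation.Coinvariants.ker (translationRep X 8)) ≤ 624 :=
  (h hX hK).1

/-- Clause (i′): `dim_ℝ 𝒦_ℝ ≤ 624`. [cite: Foster2024, Remark 88] -/
theorem finrank_coinvariantsKer_real_le (h : Foster2024_translationAction_kum4Type)
    {X : Motives.SchemeOver ℂ} (hX : Motives.IsSmoothProjective 8 X)
    (hK : IsOfGeneralizedKummerType 4 X) :
    Module.finrank ℝ (Representation.Coinvariants.ker (translationRepReal X 8)) ≤ 624 :=
  (h hX hK).2.1

/-- Clause (ii): off the middle degree every class is `Γ(X)`-fixed, `ρ(g) c = c`.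
[cite: Foster2024, Lemma 85] -/
theorem translationRep_apply_of_ne (h : Foster2024_translationAction_kum4Type)
    {X : Motives.SchemeOver ℂ} (hX : Motives.IsSmoothProjective 8 X)
    (hK : IsOfGeneralizedKummerType 4 X) {k : ℕ} (hk : k ≠ 8) (g : autFixingH2H3 X)
    (c : complexBetti X k) : translationRep X k g c = c := by
  rw [translationRep_apply, (h hX hK).2.2 k hk _ (g⁻¹).2]
  rfl

end Foster2024_translationAction_kum4Type

/-! ### The group structure of `Γ(X)`: `Γ(X) ≅ (ℤ/(n+1)ℤ)⁴` — Kummer translation frames (added by the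
literature seat of `hodge-kum4`, 2026-08-25; consumer: the planner's `KummerTranslationFrameExists`) -/

/-- **Boissière–Nieper-Wißkirchen–Sarti 2011 ∧ Hassett–Tschinkel 2013, as stated by Floccari–Varesco
(Math. Ann. 2025, §3, first paragraph), verbatim: "Let `X` be a `Kumⁿ`-variety, `n ≥ 2`. […] The
automorphisms of `X` which act trivially on its second and third cohomology groups form a group
`Γₙ ≅ (ℤ/(n+1)ℤ)⁴`, by [boissiere2011higher, hassettTschinkel]."**  Rendering: `Γ(X)` is this file's
`autFixingH2H3 X` (automorphisms of the `ℂ`-scheme with `g^* = 1` on `H²(X(ℂ); ℂ)` and `H³(X(ℂ); ℂ)` —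
acting trivially with `ℂ`-coefficients is acting trivially with `ℚ`-coefficients), and "`≅ (ℤ/(n+1)ℤ)⁴`"
is a group isomorphism with `Multiplicative (Fin 4 → ZMod (n + 1))`.  At the Kummer point
`Γ = A[n+1]` acting by translations (BNWS: `Aut` of `Kⁿ(A)` trivial on `H²` is `A[n+1] ⋊ ⟨-1⟩`);
transported to every `X` of the type by the deformation invariance of this group of automorphisms
(Hassett–Tschinkel Thm. 2.1); `-1` and its coset act as `-1` on `H³` (Oguiso, via Floccari 2023 §2.5).
It refines `Floccari2026_card_autFixingH2H3_kum4Type` (`|Γ(X)| = 625`, PROVED below from this record: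
`card_eq`, `floccari2026_card`).  A THEOREM in print (REFEREED: JMPA 2011, MMJ 2013, Math. Ann. 2025;
unproved in the tree). [cite: FloccariVaresco2024, §3 first paragraph (arXiv:2308.04865 p. 6 L4)]
[cite: BoissiereNieperWisskirchenSarti2011, Thm. on Aut(Kⁿ(A)) acting trivially on H² = A[n+1] ⋊ ℤ/2 (via FloccariVaresco2024 §3)]
[cite: HassettTschinkel2010, Thm. 2.1 (deformation invariance of the automorphisms acting trivially on H²)] -/
def FloccariVaresco2024_autFixingH2H3_equiv_kumType : Prop :=
  ∀ (n : ℕ), 2 ≤ n → ∀ ⦃X : Motives.SchemeOver ℂ⦄, Motives.IsSmoothProjective (2 * n) X →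
    IsOfGeneralizedKummerType n X →
      Nonempty (autFixingH2H3 X ≃* Multiplicative (Fin 4 → ZMod (n + 1)))

namespace FloccariVaresco2024_autFixingH2H3_equiv_kumType

/-- `|Γ(X)| = (n+1)⁴`. [cite: FloccariVaresco2024, §3 first paragraph] -/
theorem card_eq (h : FloccariVaresco2024_autFixingH2H3_equiv_kumType) {n : ℕ} (hn : 2 ≤ n)
    {X : Motives.SchemeOver ℂ} (hX : Motives.IsSmoothProjective (2 * n) X)
    (hK : IsOfGeneralizedKummerType n X) : Nat.card (autFixingH2H3 X) = (n + 1) ^ 4 := by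
  obtain ⟨e⟩ := h n hn hX hK
  rw [Nat.card_congr e.toEquiv, Nat.card_congr Multiplicative.toAdd, Nat.card_pi, Fin.prod_const,
    Nat.card_zmod]

/-- This record implies the `|Γ(X)| = 625` record of this file (`Kum⁴`: `5⁴ = 625`).
[cite: FloccariVaresco2024, §3 first paragraph] [cite: Floccari2026, §4.4 proof of Prop. 4.6] -/
theorem floccari2026_card (h : FloccariVaresco2024_autFixingH2H3_equiv_kumType) :
    Floccari2026_card_autFixingH2H3_kum4Type :=
  fun _ hX hK ↦ h.card_eq (by norm_num) hX hK

/-- **Kummer translation frames exist** (the planner's `KummerTranslationFrameExists`, cell `hodge-kum4`,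
HOME/plan/Statement.lean §1, with its body spelled out): every smooth projective `Kum⁴`-type `X`
carries `g : (ℤ/5)⁴ → End X` with `g 0 = 𝟙`, `g (a + b) = g a ≫ g b`, `g a ≠ 𝟙` for `a ≠ 0`, and every
`g a` acting trivially on `H²(X(ℂ); ℂ)` and `H³(X(ℂ); ℂ)` — namely (the underlying morphisms of) the
inverse of an isomorphism `Γ(X) ≅ (ℤ/5)⁴`. [cite: FloccariVaresco2024, §3 first paragraph]
[cite: BoissiereNieperWisskirchenSarti2011, Aut(Kⁿ(A)) trivial on H² = A[n+1] ⋊ ℤ/2] -/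
theorem exists_frame_kum4Type (h : FloccariVaresco2024_autFixingH2H3_equiv_kumType)
    {X : Motives.SchemeOver ℂ} (hX : Motives.IsSmoothProjective 8 X) (hK : IsOfGeneralizedKummerType 4 X) :
    ∃ g : (Fin 4 → ZMod 5) → (X ⟶ X),
      g 0 = 𝟙 X ∧ (∀ a b, g (a + b) = g a ≫ g b) ∧ (∀ a, a ≠ 0 → g a ≠ 𝟙 X) ∧
        (∀ (a : Fin 4 → ZMod 5) (c : complexBetti X 2), complexBetti.map (g a) 2 c = c) ∧
        (∀ (a : Fin 4 → ZMod 5) (c : complexBetti X 3), complexBetti.map (g a) 3 c = c) := by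
  obtain ⟨e⟩ := h 4 (by norm_num) hX hK
  -- the frame: `a ↦` the automorphism `e⁻¹(a) ∈ Γ(X) ≤ Aut X`, as a morphism `X ⟶ X`
  let γ : (Fin 4 → ZMod 5) → autFixingH2H3 X := fun a ↦ e.symm (Multiplicative.ofAdd a)
  have hγmul : ∀ a b, γ (a + b) = γ a * γ b := fun a b ↦ by
    simp only [γ, ofAdd_add, map_mul]
  refine ⟨fun a ↦ ((γ a : autFixingH2H3 X) : Aut X).hom, ?_, ?_, ?_, ?_, ?_⟩
  · -- `g 0 = 𝟙`
    have h0 : ((γ 0 : autFixingH2H3 X) : Aut X) = 1 := by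
      have : γ 0 = 1 := by simp only [γ, ofAdd_zero, map_one]
      rw [this]; rfl
    exact (congrArg Iso.hom h0).trans rfl
  · -- `g (a + b) = g a ≫ g b` (the group is commutative; `(x * y).hom = y.hom ≫ x.hom` in `Aut X`)
    intro a b
    have hab : ((γ (a + b) : autFixingH2H3 X) : Aut X) =
        ((γ b : autFixingH2H3 X) : Aut X) * ((γ a : autFixingH2H3 X) : Aut X) := by
      rw [add_comm, hγmul]; rfl
    exact (congrArg Iso.hom hab).trans rfl
  · -- faithfulness
    intro a ha hga
    apply ha
    have h1 : ((γ a : autFixingH2H3 X) : Aut X) = 1 := Iso.ext hga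
    have h2 : γ a = 1 := Subtype.ext h1
    have h3 : Multiplicative.ofAdd a = 1 := by
      have := congrArg e h2
      simpa only [γ, MulEquiv.apply_symm_apply, map_one] using this
    exact ofAdd_eq_one.mp h3
  · intro a c
    show complexBetti.map ((γ a : autFixingH2H3 X) : Aut X).hom 2 c = c
    rw [((γ a).2).1]; rfl
  · intro a c
    show complexBetti.map ((γ a : autFixingH2H3 X) : Aut X).hom 3 c = c
    rw [((γ a).2).2]; rfl

end FloccariVaresco2024_autFixingH2H3_equiv_kumType

end Literature.AlgebraicGeometry.Hyperkaehler

end
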